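import Summits.Parity.GeneralizedHardyLittlewood.Theorems.LeeYangFibresRelativeDimOneTypeDefs
import Summits.Parity.GeneralizedHardyLittlewood.Theorems.LeeYangFibresRelativeDimOneTypeDataD
import Literature.NumberTheory.Sieve.SieveFrameworkProofs
import HarnessLib

/-!
# Type rigidity for the reshaped line `gallagher-backwards-split` (crux stmt-Parity-14113
`LeeYangFibres.RelativeDimOne`, stub `stub_typeRigidity`): finite sums over the divisors of primorials and the
threshold for the conditioning height

Pure finite-sum / threshold lemmas (no spectra, no type cells) for the lead's assembly of `TypeRigidity`
(`|sfBand − smoothBand| ≤ C Σ_{q ≤ Q sqfree, not w-smooth} wprod q ≤ C (Σ_{d ∣ ∏_{p≤w} p} wprod d)(Σ_{r rough} wprod r)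
 = C · G_w · (∏_{w<p≤Q}(1 + wt p) − 1) ≤ 2C · G_w · Σ_{w<p≤Q} wt p`):
* `sum_divisors_prod_primes_eq`, `rigidity_sum_divisors_primorial` (registered hook):
  `Σ_{d ∣ ∏_{p ≤ w} p} ∏_{p ∣ d} g(p) = ∏_{p ≤ w} (1 + g(p))`;
* `sum_rough_le_prod_sub_one`, `prod_one_add_sub_one_le`:
  `Σ_{r ∈ R} ∏_{p ∣ r} g(p) ≤ ∏_{p ∈ T} (1 + g(p)) − 1 ≤ 2s` for squarefree `r ≠ 1` supported on the primes of `T`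
  and `Σ_T g ≤ s ≤ 1`;
* `rough_decomp`: `q = q₁ q₂` with `q₁ = gcd(q, ∏_{p ≤ w} p)` (`w`-smooth, a divisor of the primorial) and `q₂`
  squarefree, `w`-rough, coprime to `q₁`; `q` is `w`-smooth iff `q₂ = 1`;
* `sum_nonsmooth_le_mul`: `Σ_{q ≤ Q sqfree, not w-smooth} F(q₁) G(q₂) ≤ (Σ_{d ∣ ∏_{p≤w} p} F d)(Σ_{2 ≤ r ≤ Q rough sqfree} G r)`
  (the map `q ↦ (q₁, q₂)` is injective);
* `roughFinset_spec`, `sum_inv_sq_primes_tail_le`: the rough moduli are supported on the primes in `(w, Q]`, and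
  `Σ_{w < p ≤ Q} 1/p² ≤ 1/w`;
* `rigidity_threshold` (registered hook): for `N ≥ N₀(t, L, D, K, s)` the height `w = wlev D N = ⌊log₄ N⌋ / D`
  satisfies `L < w`, `2t ≤ w`, `2 ≤ w`, `2t²/w + (4t/w) · t² log(2L²N)/log w ≤ s` and `K/w ≤ s`
  (as `N < 4^{D(w+1)}`, `log(2L²N) ≤ 2 log N ≤ 12 D w`).
-/

noncomputable section

open scoped BigOperators Classical
open Finset Literature.NumberTheory.Sieve

namespace Summit.Parity.GeneralizedHardyLittlewood.Cruxes.RelativeDimOne.TypeSplit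

/-! ### Divisor sums over products of distinct primes -/

/-- For a finite set `S` of primes: `Σ_{d ∣ ∏ S} ∏_{p ∣ d} g(p) = ∏_{p ∈ S} (1 + g(p))` (induction on `S`: the
divisors of `p · ∏ S` are `b` and `p b`, `b ∣ ∏ S`, and `(p b).primeFactors = insert p b.primeFactors`). -/
theorem sum_divisors_prod_primes_eq (S : Finset ℕ) (hS : ∀ p ∈ S, p.Prime) (g : ℕ → ℝ) :
    ∑ d ∈ (∏ p ∈ S, p).divisors, ∏ p ∈ d.primeFactors, g p = ∏ p ∈ S, (1 + g p) := by
  induction S using Finset.induction_on with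
  | empty => simp
  | insert p S hpS ih =>
    have hp : p.Prime := hS p (Finset.mem_insert_self p S)
    have hS' : ∀ q ∈ S, q.Prime := fun q hq => hS q (Finset.mem_insert_of_mem hq)
    rw [Finset.prod_insert hpS, Finset.prod_insert hpS]
    have hcop : Nat.Coprime p (∏ q ∈ S, q) := by
      refine Nat.Coprime.prod_right fun q hq => ?_
      exact (Nat.coprime_primes hp (hS' q hq)).mpr (fun h => hpS (h ▸ hq))
    rw [sum_divisors_mul_of_coprime hcop, hp.divisors, Finset.sum_pair hp.one_lt.ne]
    simp only [one_mul]
    rw [ih hS']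
    have hsum : ∑ b ∈ (∏ q ∈ S, q).divisors, ∏ r ∈ (p * b).primeFactors, g r =
        g p * ∑ b ∈ (∏ q ∈ S, q).divisors, ∏ r ∈ b.primeFactors, g r := by
      rw [Finset.mul_sum]
      refine Finset.sum_congr rfl fun b hb => ?_
      have hbdvd : b ∣ ∏ q ∈ S, q := Nat.dvd_of_mem_divisors hb
      have hcopb : Nat.Coprime p b := hcop.coprime_dvd_right hbdvd
      have hpb : p ∉ b.primeFactors := fun h =>
        hp.one_lt.ne' (Nat.Coprime.eq_one_of_dvd hcopb (Nat.dvd_of_mem_primeFactors h))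
      rw [Nat.Coprime.primeFactors_mul hcopb, hp.primeFactors, ← Finset.insert_eq, Finset.prod_insert hpb]
    rw [hsum, ih hS']
    ring

/-- Registered hook (aux for `stub_typeRigidity`): `Σ_{d ∣ ∏_{p ≤ w} p} ∏_{p ∣ d} g(p) = ∏_{p ≤ w} (1 + g(p))`
(with `g = wt a b₀` this is `Σ_{d ∣ ∏_{p ≤ w} p} wprod d a b₀ = G_w(a, b₀)`). -/
theorem rigidity_sum_divisors_primorial : ∀ (w : ℕ) (g : ℕ → ℝ), ∑ d ∈ (primorial w).divisors, ∏ p ∈ d.primeFactors, g p = ∏ p ∈ Nat.primesLE w, (1 + g p) :=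
  fun w g => by
    rw [primorial_eq_prod_primesLE]
    exact sum_divisors_prod_primes_eq _ (fun _ hp => Nat.prime_of_mem_primesLE hp) g

/-- For a finite set `T` of primes, a nonnegative `g`, and a finite set `R` of squarefree `r ≠ 1` all of whose prime
factors lie in `T`: `Σ_{r ∈ R} ∏_{p ∣ r} g(p) ≤ ∏_{p ∈ T} (1 + g(p)) − 1` (`R ⊆ divisors (∏ T) ∖ {1}`). -/
theorem sum_rough_le_prod_sub_one (T R : Finset ℕ) (g : ℕ → ℝ) (hT : ∀ p ∈ T, p.Prime) (hg : ∀ p, 0 ≤ g p)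
    (hR : ∀ r ∈ R, Squarefree r ∧ r ≠ 1 ∧ r.primeFactors ⊆ T) :
    ∑ r ∈ R, ∏ p ∈ r.primeFactors, g p ≤ ∏ p ∈ T, (1 + g p) - 1 := by
  have key := sum_divisors_prod_primes_eq T hT g
  have hM0 : (∏ p ∈ T, p) ≠ 0 := Finset.prod_ne_zero_iff.2 fun p hp => (hT p hp).ne_zero
  have h1M : (1 : ℕ) ∈ (∏ p ∈ T, p).divisors := Nat.one_mem_divisors.2 hM0
  have hsub : R ⊆ (∏ p ∈ T, p).divisors.erase 1 := by
    intro r hr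
    obtain ⟨hsq, hr1, hrT⟩ := hR r hr
    refine Finset.mem_erase.2 ⟨hr1, Nat.mem_divisors.2 ⟨?_, hM0⟩⟩
    rw [← Nat.prod_primeFactors_of_squarefree hsq]
    exact Finset.prod_dvd_prod_of_subset _ _ _ hrT
  calc ∑ r ∈ R, ∏ p ∈ r.primeFactors, g p
      ≤ ∑ d ∈ (∏ p ∈ T, p).divisors.erase 1, ∏ p ∈ d.primeFactors, g p :=
        Finset.sum_le_sum_of_subset_of_nonneg hsub fun d _ _ => Finset.prod_nonneg fun p _ => hg p
    _ = ∑ d ∈ (∏ p ∈ T, p).divisors, ∏ p ∈ d.primeFactors, g p - 1 := by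
        rw [Finset.sum_erase_eq_sub h1M, Nat.primeFactors_one, Finset.prod_empty]
    _ = ∏ p ∈ T, (1 + g p) - 1 := by rw [key]

/-- `∏_{p ∈ T} (1 + g(p)) − 1 ≤ 2s` for a nonnegative `g` with `Σ_{p ∈ T} g(p) ≤ s ≤ 1`
(`∏ (1 + g) ≤ exp(Σ g) ≤ exp s` and `exp s − 1 ≤ 2s` on `[0, 1]`). -/
theorem prod_one_add_sub_one_le (T : Finset ℕ) (g : ℕ → ℝ) (hg : ∀ p, 0 ≤ g p) {s : ℝ}
    (hs : ∑ p ∈ T, g p ≤ s) (hs1 : s ≤ 1) : ∏ p ∈ T, (1 + g p) - 1 ≤ 2 * s := by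
  have h0 : 0 ≤ s := le_trans (Finset.sum_nonneg fun p _ => hg p) hs
  have h1 : ∏ p ∈ T, (1 + g p) ≤ Real.exp s :=
    (Real.prod_one_add_le_exp_sum T hg).trans (Real.exp_le_exp.2 hs)
  have h2 : Real.exp s - 1 ≤ 2 * s := by
    have h := Real.abs_exp_sub_one_le (x := s) (by rw [abs_of_nonneg h0]; exact hs1)
    rw [abs_of_nonneg h0] at h
    exact (le_abs_self _).trans h
  linarith

/-! ### The smooth and rough parts of a squarefree modulus -/

/-- The smooth/rough DECOMPOSITION of a squarefree modulus: with `P = ∏_{p ≤ w} p`, `q₁ = gcd(q, P)`, `q₂ = q/q₁`: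
`q = q₁ q₂`, `gcd(q₁, q₂) = 1`, `q₁ ∣ P`, `q₂` squarefree, every prime factor of `q₂` exceeds `w`, every prime factor of
`q₁` is `≤ w`, and `q` is `w`-smooth iff `q₂ = 1`. -/
theorem rough_decomp (w : ℕ) {q : ℕ} (hq : 1 ≤ q) (hsq : Squarefree q) :
    q = Nat.gcd q (primorial w) * (q / Nat.gcd q (primorial w)) ∧
    Nat.Coprime (Nat.gcd q (primorial w)) (q / Nat.gcd q (primorial w)) ∧
    Nat.gcd q (primorial w) ∣ primorial w ∧
    Squarefree (q / Nat.gcd q (primorial w)) ∧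
    (∀ p ∈ (q / Nat.gcd q (primorial w)).primeFactors, w < p) ∧
    (∀ p ∈ (Nat.gcd q (primorial w)).primeFactors, p ≤ w) ∧
    ((∀ p ∈ q.primeFactors, p ≤ w) ↔ q / Nat.gcd q (primorial w) = 1) := by
  have hq₁q : Nat.gcd q (primorial w) ∣ q := Nat.gcd_dvd_left q _
  have hq₁P : Nat.gcd q (primorial w) ∣ primorial w := Nat.gcd_dvd_right q _
  have hqq : q = Nat.gcd q (primorial w) * (q / Nat.gcd q (primorial w)) := by
    rw [mul_comm, Nat.div_mul_cancel hq₁q]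
  have hcop : Nat.Coprime (Nat.gcd q (primorial w)) (q / Nat.gcd q (primorial w)) :=
    Nat.coprime_of_squarefree_mul (hqq ▸ hsq)
  have hq₂q : q / Nat.gcd q (primorial w) ∣ q := Nat.div_dvd_of_dvd hq₁q
  have hsq₂ : Squarefree (q / Nat.gcd q (primorial w)) := hsq.squarefree_of_dvd hq₂q
  have hrough : ∀ p ∈ (q / Nat.gcd q (primorial w)).primeFactors, w < p := by
    intro p hp
    have hp' := Nat.mem_primeFactors.1 hp
    by_contra hle
    have hpP : p ∣ primorial w := hp'.1.dvd_primorial_iff.2 (not_lt.1 hle)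
    have hpq₁ : p ∣ Nat.gcd q (primorial w) := Nat.dvd_gcd (hp'.2.1.trans hq₂q) hpP
    have h1 : p ∣ Nat.gcd (Nat.gcd q (primorial w)) (q / Nat.gcd q (primorial w)) :=
      Nat.dvd_gcd hpq₁ hp'.2.1
    rw [hcop.gcd_eq_one, Nat.dvd_one] at h1
    exact hp'.1.one_lt.ne' h1
  have hsmooth : ∀ p ∈ (Nat.gcd q (primorial w)).primeFactors, p ≤ w := fun p hp =>
    (Nat.prime_of_mem_primeFactors hp).dvd_primorial_iff.1 ((Nat.dvd_of_mem_primeFactors hp).trans hq₁P)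
  have _h := hq
  refine ⟨hqq, hcop, hq₁P, hsq₂, hrough, hsmooth, ⟨fun hall => ?_, fun h1 p hp => ?_⟩⟩
  · by_contra hne
    have hlt : 1 < q / Nat.gcd q (primorial w) :=
      lt_of_le_of_ne (Nat.one_le_iff_ne_zero.2 hsq₂.ne_zero) (Ne.symm hne)
    obtain ⟨p, hp⟩ := Nat.nonempty_primeFactors.2 hlt
    have hpq : p ∈ q.primeFactors := Nat.mem_primeFactors.2
      ⟨Nat.prime_of_mem_primeFactors hp, (Nat.dvd_of_mem_primeFactors hp).trans hq₂q, by omega⟩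
    exact absurd (hall p hpq) (not_le.2 (hrough p hp))
  · have hqd : q ∣ primorial w := by
      rw [hqq, h1, mul_one]
      exact hq₁P
    exact (Nat.prime_of_mem_primeFactors hp).dvd_primorial_iff.1 ((Nat.dvd_of_mem_primeFactors hp).trans hqd)

/-- The non-smooth part of a sum over squarefree moduli factors through the smooth and rough sums: for nonnegative
`F, G`, `Σ_{q ≤ Q sqfree, not w-smooth} F(gcd(q, P)) G(q / gcd(q, P)) ≤ (Σ_{d ∣ P} F d) (Σ_{2 ≤ r ≤ Q sqfree, w-rough} G r)`,
`P = ∏_{p ≤ w} p` (the map `q ↦ (gcd(q, P), q / gcd(q, P))` is injective, its image lies in the product set). -/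
theorem sum_nonsmooth_le_mul (Q w : ℕ) (F G : ℕ → ℝ) (hF : ∀ d, 0 ≤ F d) (hG : ∀ r, 0 ≤ G r) :
    ∑ q ∈ (((Finset.Icc 1 Q).filter Squarefree).filter (fun q => ¬ ∀ p ∈ q.primeFactors, p ≤ w)),
        F (Nat.gcd q (primorial w)) * G (q / Nat.gcd q (primorial w)) ≤
      (∑ d ∈ (primorial w).divisors, F d) *
        (∑ r ∈ ((Finset.Icc 2 Q).filter Squarefree).filter (fun r => ∀ p ∈ r.primeFactors, w < p), G r) := by
  have key : ∀ q ∈ (((Finset.Icc 1 Q).filter Squarefree).filter (fun q => ¬ ∀ p ∈ q.primeFactors, p ≤ w)),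
      q = Nat.gcd q (primorial w) * (q / Nat.gcd q (primorial w)) ∧
      Nat.gcd q (primorial w) ∈ (primorial w).divisors ∧
      q / Nat.gcd q (primorial w) ∈
        ((Finset.Icc 2 Q).filter Squarefree).filter (fun r => ∀ p ∈ r.primeFactors, w < p) := by
    intro q hq
    simp only [Finset.mem_filter, Finset.mem_Icc] at hq
    obtain ⟨⟨⟨hq1, hqQ⟩, hsq⟩, hns⟩ := hq
    obtain ⟨hqq, -, hdvd, hsq₂, hrough, -, hiff⟩ := rough_decomp w hq1 hsq
    refine ⟨hqq, Nat.mem_divisors.2 ⟨hdvd, (primorial_pos w).ne'⟩, ?_⟩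
    simp only [Finset.mem_filter, Finset.mem_Icc]
    refine ⟨⟨⟨?_, (Nat.div_le_self _ _).trans hqQ⟩, hsq₂⟩, hrough⟩
    have h1 : q / Nat.gcd q (primorial w) ≠ 1 := fun h => hns (hiff.2 h)
    have h0 : q / Nat.gcd q (primorial w) ≠ 0 := hsq₂.ne_zero
    generalize q / Nat.gcd q (primorial w) = x at h0 h1 ⊢
    omega
  calc ∑ q ∈ (((Finset.Icc 1 Q).filter Squarefree).filter (fun q => ¬ ∀ p ∈ q.primeFactors, p ≤ w)),
        F (Nat.gcd q (primorial w)) * G (q / Nat.gcd q (primorial w))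
      = ∑ x ∈ (((Finset.Icc 1 Q).filter Squarefree).filter (fun q => ¬ ∀ p ∈ q.primeFactors, p ≤ w)).image
          (fun q => (Nat.gcd q (primorial w), q / Nat.gcd q (primorial w))), F x.1 * G x.2 := by
        rw [Finset.sum_image]
        intro q hq q' hq' h
        simp only [Prod.mk.injEq] at h
        calc q = Nat.gcd q (primorial w) * (q / Nat.gcd q (primorial w)) := (key q hq).1
          _ = Nat.gcd q' (primorial w) * (q' / Nat.gcd q' (primorial w)) := by rw [h.2, h.1]
          _ = q' := (key q' hq').1.symm
    _ ≤ ∑ x ∈ (primorial w).divisors ×ˢ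
          ((Finset.Icc 2 Q).filter Squarefree).filter (fun r => ∀ p ∈ r.primeFactors, w < p), F x.1 * G x.2 := by
        refine Finset.sum_le_sum_of_subset_of_nonneg (fun x hx => ?_) (fun x _ _ => mul_nonneg (hF _) (hG _))
        rw [Finset.mem_image] at hx
        obtain ⟨q, hq, rfl⟩ := hx
        exact Finset.mem_product.2 ⟨(key q hq).2.1, (key q hq).2.2⟩
    _ = (∑ d ∈ (primorial w).divisors, F d) *
        (∑ r ∈ ((Finset.Icc 2 Q).filter Squarefree).filter (fun r => ∀ p ∈ r.primeFactors, w < p), G r) := by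
        rw [Finset.sum_product, Finset.sum_mul_sum]

/-- Membership in the rough index set: `r ∈ {2 ≤ r ≤ Q : r squarefree, every prime factor > w}` gives `r` squarefree,
`r ≠ 1`, and `r.primeFactors ⊆ primesLE Q ∖ primesLE w`. -/
theorem roughFinset_spec (Q w : ℕ) {r : ℕ} :
    r ∈ ((Finset.Icc 2 Q).filter Squarefree).filter (fun r => ∀ p ∈ r.primeFactors, w < p) →
      Squarefree r ∧ r ≠ 1 ∧ r.primeFactors ⊆ Nat.primesLE Q \ Nat.primesLE w := by
  intro hr
  simp only [Finset.mem_filter, Finset.mem_Icc] at hr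
  obtain ⟨⟨⟨h2r, hrQ⟩, hsq⟩, hrough⟩ := hr
  refine ⟨hsq, by omega, fun p hp => ?_⟩
  have hpp : p.Prime := Nat.prime_of_mem_primeFactors hp
  have hpr : p ≤ r := Nat.le_of_dvd (by omega) (Nat.dvd_of_mem_primeFactors hp)
  rw [Finset.mem_sdiff, Nat.mem_primesLE, Nat.mem_primesLE]
  exact ⟨⟨hpr.trans hrQ, hpp⟩, fun h => absurd h.1 (not_le.2 (hrough p hp))⟩

/-- `Σ_{p ∈ primesLE Q ∖ primesLE w} 1/p² ≤ 1/w` for `1 ≤ w` (the primes lie in `(w, Q]`, and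
`Σ_{w < n ≤ Q} 1/n² ≤ 1/w − 1/Q`). -/
theorem sum_inv_sq_primes_tail_le (w Q : ℕ) (hw : 1 ≤ w) :
    ∑ p ∈ Nat.primesLE Q \ Nat.primesLE w, (1 : ℝ) / (p : ℝ) ^ 2 ≤ 1 / w := by
  have hsub : Nat.primesLE Q \ Nat.primesLE w ⊆ Finset.Ioc w Q := by
    intro p hp
    rw [Finset.mem_sdiff, Nat.mem_primesLE, Nat.mem_primesLE] at hp
    rw [Finset.mem_Ioc]
    exact ⟨not_le.1 fun h => hp.2 ⟨h, hp.1.2⟩, hp.1.1⟩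
  calc ∑ p ∈ Nat.primesLE Q \ Nat.primesLE w, (1 : ℝ) / (p : ℝ) ^ 2
      ≤ ∑ n ∈ Finset.Ioc w Q, (1 : ℝ) / (n : ℝ) ^ 2 :=
        Finset.sum_le_sum_of_subset_of_nonneg hsub fun n _ _ => by positivity
    _ ≤ 1 / w := by
        rcases le_or_gt w Q with hwQ | hQw
        · have h := sum_Ioc_inv_sq_le_sub (α := ℝ) (by omega : w ≠ 0) hwQ
          have hQ : (0 : ℝ) ≤ (Q : ℝ)⁻¹ := by positivity
          simp only [one_div]
          linarith
        · rw [Finset.Ioc_eq_empty (by omega), Finset.sum_empty]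
          positivity

/-! ### The threshold for the conditioning height `w = ⌊log₄ N⌋ / D` -/

/-- Registered hook (aux for `stub_typeRigidity`): the threshold `N₀(t, L, D, K, s)` beyond which the conditioning
height `w = wlev D N` satisfies `L < w`, `2t ≤ w`, `2 ≤ w`,
`t²/w + (4t/w) · t² log(2L²N)/log w + t²/w ≤ s` and `K/w ≤ s` (with `N₀ = 4^{D W₀}`: `w ≥ W₀`, `N < 4^{D(w+1)}`,
so `log(2L²N) ≤ 2 log N ≤ 12 D w` and the middle term is `≤ 48 t³ D/log w`). -/
theorem rigidity_threshold : ∀ (t L D : ℕ) (K s : ℝ), 1 ≤ D → 0 ≤ K → 0 < s → ∃ N₀ : ℕ, ∀ N : ℕ, N₀ ≤ N → L < wlev D N ∧ 2 * t ≤ wlev D N ∧ 2 ≤ wlev D N ∧ (t : ℝ) ^ 2 / (wlev D N : ℕ) + 4 * t / (wlev D N : ℕ) * ((t : ℝ) ^ 2 * (Real.log ((2 * L ^ 2 * N : ℕ) : ℝ) / Real.log (wlev D N : ℕ))) + (t : ℝ) ^ 2 / (wlev D N : ℕ) ≤ s ∧ K / (wlev D N : ℕ) ≤ s := by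
  intro t L D K s hD _hK hs
  -- the threshold for `w`
  set W₀ : ℕ := max (max (L + 1) (max (2 * t) 2))
    (max (max (2 * L ^ 2) ⌈K / s⌉₊) (max ⌈4 * (t : ℝ) ^ 2 / s⌉₊ ⌈Real.exp (96 * (t : ℝ) ^ 3 * D / s)⌉₊)) with hW₀
  refine ⟨4 ^ (D * W₀), fun N hN => ?_⟩
  -- `W₀ ≤ w`
  have hlog : D * W₀ ≤ Nat.log 4 N := Nat.le_log_of_pow_le (by norm_num) hN
  have hw : W₀ ≤ wlev D N := by
    unfold wlev
    exact (Nat.le_div_iff_mul_le (by omega)).2 (by rw [Nat.mul_comm]; exact hlog)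
  have hlt : Nat.log 4 N < D * (wlev D N + 1) := by
    unfold wlev
    exact Nat.lt_mul_div_succ _ (by omega)
  set w := wlev D N with hwdef
  have hKs : ⌈K / s⌉₊ ≤ W₀ := by omega
  have hts : ⌈4 * (t : ℝ) ^ 2 / s⌉₊ ≤ W₀ := by omega
  have hexp : ⌈Real.exp (96 * (t : ℝ) ^ 3 * D / s)⌉₊ ≤ W₀ := by omega
  have hLL : 2 * L ^ 2 ≤ W₀ := by omega
  have hy0 : (0 : ℝ) < w := by exact_mod_cast (by omega : 0 < w)
  have hlogy : 0 < Real.log w := Real.log_pos (by exact_mod_cast (by omega : 1 < w))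
  -- `1 ≤ N`, `W₀ ≤ N`
  have hW₀N : W₀ ≤ N := by
    have h1 : W₀ < 4 ^ W₀ := Nat.lt_pow_self (by norm_num)
    have h2 : 4 ^ W₀ ≤ 4 ^ (D * W₀) :=
      Nat.pow_le_pow_right (by norm_num) (Nat.le_mul_of_pos_left W₀ (by omega))
    omega
  have hNr : (0 : ℝ) < N := by exact_mod_cast (by omega : 0 < N)
  -- `log N ≤ 3 D (w + 1)`
  have hlogN : Real.log N ≤ 3 * ((D : ℝ) * ((w : ℝ) + 1)) := by
    have h2 : N < 4 ^ (D * (w + 1)) :=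
      (Nat.lt_pow_succ_log_self (by norm_num : 1 < 4) N).trans_le (Nat.pow_le_pow_right (by norm_num) hlt)
    have h3 : (N : ℝ) ≤ (4 : ℝ) ^ (D * (w + 1)) := by exact_mod_cast h2.le
    have h4 : Real.log N ≤ Real.log ((4 : ℝ) ^ (D * (w + 1))) := Real.log_le_log hNr h3
    rw [Real.log_pow] at h4
    have h6 : Real.log (4 : ℝ) ≤ 3 := by
      have := Real.log_le_sub_one_of_pos (by norm_num : (0 : ℝ) < 4)
      linarith
    have h7 : (0 : ℝ) ≤ ((D * (w + 1) : ℕ) : ℝ) := Nat.cast_nonneg _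
    calc Real.log N ≤ ((D * (w + 1) : ℕ) : ℝ) * Real.log 4 := h4
      _ ≤ ((D * (w + 1) : ℕ) : ℝ) * 3 := mul_le_mul_of_nonneg_left h6 h7
      _ = 3 * ((D : ℝ) * ((w : ℝ) + 1)) := by push_cast; ring
  -- `log (2 L² N) ≤ 12 D w`
  have hH : Real.log ((2 * L ^ 2 * N : ℕ) : ℝ) ≤ 12 * D * (w : ℝ) := by
    have h1 : 2 * L ^ 2 * N ≤ N * N := Nat.mul_le_mul_right N (by omega)
    have h2 : Real.log ((2 * L ^ 2 * N : ℕ) : ℝ) ≤ Real.log ((N * N : ℕ) : ℝ) := by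
      rcases Nat.eq_zero_or_pos (2 * L ^ 2 * N) with h0 | hpos
      · rw [h0, Nat.cast_zero, Real.log_zero]
        exact Real.log_natCast_nonneg _
      · exact Real.log_le_log (by exact_mod_cast hpos) (by exact_mod_cast h1)
    have h3 : Real.log ((N * N : ℕ) : ℝ) = 2 * Real.log N := by
      push_cast
      rw [Real.log_mul hNr.ne' hNr.ne']
      ring
    have hD0 : (0 : ℝ) ≤ D := Nat.cast_nonneg _
    have hy1 : (1 : ℝ) ≤ w := by exact_mod_cast (by omega : 1 ≤ w)
    have h4 : (D : ℝ) * ((w : ℝ) + 1) ≤ 2 * D * w := by nlinarith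
    linarith [hlogN]
  -- (e) `K / w ≤ s`
  have hKw : K / (w : ℝ) ≤ s := by
    have h1 : K / s ≤ ⌈K / s⌉₊ := Nat.le_ceil _
    have h2 : (⌈K / s⌉₊ : ℝ) ≤ w := by exact_mod_cast hKs.trans hw
    have h3 : K / s ≤ w := h1.trans h2
    rw [div_le_iff₀ hs] at h3
    rw [div_le_iff₀ hy0]
    linarith
  -- (d₁) `t²/w ≤ s/4`
  have hA : (t : ℝ) ^ 2 / w ≤ s / 4 := by
    have h1 : 4 * (t : ℝ) ^ 2 / s ≤ ⌈4 * (t : ℝ) ^ 2 / s⌉₊ := Nat.le_ceil _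
    have h2 : (⌈4 * (t : ℝ) ^ 2 / s⌉₊ : ℝ) ≤ w := by exact_mod_cast hts.trans hw
    have h3 : 4 * (t : ℝ) ^ 2 / s ≤ w := h1.trans h2
    rw [div_le_iff₀ hs] at h3
    rw [div_le_iff₀ hy0]
    linarith
  -- (d₂) the middle term is `≤ 48 t³ D / log w ≤ s/2`
  have hB : 4 * (t : ℝ) / w * ((t : ℝ) ^ 2 * (Real.log ((2 * L ^ 2 * N : ℕ) : ℝ) / Real.log w)) ≤ s / 2 := by
    have hT0 : (0 : ℝ) ≤ t := Nat.cast_nonneg _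
    have hD0 : (0 : ℝ) ≤ D := Nat.cast_nonneg _
    have hlogw : 96 * (t : ℝ) ^ 3 * D / s ≤ Real.log w := by
      have h1 : Real.exp (96 * (t : ℝ) ^ 3 * D / s) ≤ w := by
        have h2 : (⌈Real.exp (96 * (t : ℝ) ^ 3 * D / s)⌉₊ : ℝ) ≤ w := by exact_mod_cast hexp.trans hw
        exact (Nat.le_ceil _).trans h2
      exact (Real.le_log_iff_exp_le hy0).2 h1
    calc 4 * (t : ℝ) / w * ((t : ℝ) ^ 2 * (Real.log ((2 * L ^ 2 * N : ℕ) : ℝ) / Real.log w))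
        = 4 * (t : ℝ) ^ 3 * Real.log ((2 * L ^ 2 * N : ℕ) : ℝ) / (w * Real.log w) := by
          field_simp
      _ ≤ 4 * (t : ℝ) ^ 3 * (12 * D * w) / (w * Real.log w) := by gcongr
      _ = 48 * (t : ℝ) ^ 3 * D / Real.log w := by
          field_simp
          ring
      _ ≤ s / 2 := by
          rw [div_le_iff₀ hlogy]
          rw [div_le_iff₀ hs] at hlogw
          nlinarith
  exact ⟨by omega, by omega, by omega, by linarith, hKw⟩

end Summit.Parity.GeneralizedHardyLittlewood.Cruxes.RelativeDimOne.TypeSplit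

end
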